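import Literature.AlgebraicGeometry.Morphisms.CechModuleExactH0
import Literature.AlgebraicGeometry.Morphisms.CechModuleH2
import Mathlib.RingTheory.Length
import HarnessLib

/-!
# Additivity of lengths along the six-term Čech sequence: `χ(M) = χ(M′) + χ(M″)` in `ℕ∞`-form

For an `A`-scheme `f : X → Spec A`, a family of opens `𝒰` and a sectionwise exact `0 → M′ → M → M″ → 0`
(`CechExactData`, e.g. a short exact sequence with affine-localizing kernel on affine `U_i`), the long exact sequence
of Čech cohomology in degrees `≤ 1` (`Morphisms/CechModuleExact`, `…ExactH0`, `…H2`)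

  `0 → Ȟ⁰(M′) → Ȟ⁰(M) → Ȟ⁰(M″) → Ȟ¹(M′) → Ȟ¹(M) → Ȟ¹(M″) (→ Ȟ²(M′))`

gives, when `Ȟ¹(M) → Ȟ¹(M″)` is onto (e.g. `Ȟ²(M′) = 0`: fibres of dimension `≤ 1`, Görtz–Wedhorn II Cor. 24.44),
the ADDITIVITY OF LENGTHS

  `ℓ Ȟ⁰(M′) + ℓ Ȟ⁰(M″) + ℓ Ȟ¹(M) = ℓ Ȟ⁰(M) + ℓ Ȟ¹(M′) + ℓ Ȟ¹(M″)`   (in `ℕ∞`, no finiteness needed),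

i.e. `χ(M) = χ(M′) + χ(M″)` for `χ = ℓȞ⁰ − ℓȞ¹` whenever the lengths are finite (J. Lipman, Publ. Math. IHÉS 36
(1969), §10 p. 212: "`χ(ℱ) = h⁰(ℱ) − h¹(ℱ)`" is additive; §13 p. 223, proof of Prop. (13.1) d)).  This is the tool by
which `χ` (not only `h⁰`) enters the tree's rendering of Lipman §13 (the degree of the conormal sheaf
`𝓘_E/𝓘_E²`, `Lipman1969_13_1_d_rat` for `η = η′`).

* `length_six_term_of_exact` — algebra: lengths along an exact `A ↪ B → C → D → E ↠ F`;
* **`CechExactData.length_cechMH0_add`** — the displayed identity.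

## References
* J. Lipman, Publ. Math. IHÉS 36 (1969), §10 (p. 212), §13 (p. 223). [Lipman1969]
* R. Hartshorne, *Algebraic Geometry* (1977), III Thm. 4.5 proof (p. 222). [Hartshorne1977]
-/

noncomputable section

open CategoryTheory AlgebraicGeometry TopologicalSpace

universe u v

namespace Literature.AlgebraicGeometry.Morphisms

/-! ## §1 Lengths along a six-term exact sequence -/

section Algebra

variable {R : Type*} [CommRing R] {A B C D E F : Type*} [AddCommGroup A] [Module R A] [AddCommGroup B]
  [Module R B] [AddCommGroup C] [Module R C] [AddCommGroup D] [Module R D] [AddCommGroup E] [Module R E]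
  [AddCommGroup F] [Module R F]

/-- **Lengths along an exact sequence `0 → A → B → C → D → E → F → 0`**:
`ℓA + ℓC + ℓE = ℓB + ℓD + ℓF` in `ℕ∞` (break at the images and use additivity of length on short exact sequences).
[cite: Lipman1969, Section 10 (p. 212)] -/
theorem length_six_term_of_exact (f₁ : A →ₗ[R] B) (f₂ : B →ₗ[R] C) (f₃ : C →ₗ[R] D) (f₄ : D →ₗ[R] E)
    (f₅ : E →ₗ[R] F) (h₁ : Function.Injective f₁) (h₁₂ : Function.Exact f₁ f₂) (h₂₃ : Function.Exact f₂ f₃)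
    (h₃₄ : Function.Exact f₃ f₄) (h₄₅ : Function.Exact f₄ f₅) (h₅ : Function.Surjective f₅) :
    Module.length R A + Module.length R C + Module.length R E =
      Module.length R B + Module.length R D + Module.length R F := by
  -- `ℓB = ℓA + ℓ(im f₂)`
  have eB : Module.length R B = Module.length R A + Module.length R (LinearMap.range f₂) :=
    Module.length_eq_add_of_exact f₁ f₂.rangeRestrict h₁ f₂.surjective_rangeRestrict
      (fun b => by
        rw [← h₁₂ b]
        constructor
        · intro hb
          exact congrArg Subtype.val hb
        · intro hb
          exact Subtype.ext hb)
  -- `ℓC = ℓ(im f₂) + ℓ(im f₃)`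
  have eC : Module.length R C = Module.length R (LinearMap.range f₂) + Module.length R (LinearMap.range f₃) :=
    Module.length_eq_add_of_exact (LinearMap.range f₂).subtype f₃.rangeRestrict Subtype.val_injective
      f₃.surjective_rangeRestrict (fun c => by
        constructor
        · intro hc
          have hc' : f₃ c = 0 := congrArg Subtype.val hc
          obtain ⟨b, rfl⟩ := (h₂₃ c).mp hc'
          exact ⟨⟨f₂ b, b, rfl⟩, rfl⟩
        · rintro ⟨⟨c', b, rfl⟩, rfl⟩
          exact Subtype.ext (show f₃ (f₂ b) = 0 from (h₂₃ (f₂ b)).mpr ⟨b, rfl⟩))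
  -- `ℓD = ℓ(im f₃) + ℓ(im f₄)`
  have eD : Module.length R D = Module.length R (LinearMap.range f₃) + Module.length R (LinearMap.range f₄) :=
    Module.length_eq_add_of_exact (LinearMap.range f₃).subtype f₄.rangeRestrict Subtype.val_injective
      f₄.surjective_rangeRestrict (fun d => by
        constructor
        · intro hd
          have hd' : f₄ d = 0 := congrArg Subtype.val hd
          obtain ⟨c, rfl⟩ := (h₃₄ d).mp hd'
          exact ⟨⟨f₃ c, c, rfl⟩, rfl⟩
        · rintro ⟨⟨d', c, rfl⟩, rfl⟩
          exact Subtype.ext (show f₄ (f₃ c) = 0 from (h₃₄ (f₃ c)).mpr ⟨c, rfl⟩))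
  -- `ℓE = ℓ(im f₄) + ℓF`
  have eE : Module.length R E = Module.length R (LinearMap.range f₄) + Module.length R F :=
    Module.length_eq_add_of_exact (LinearMap.range f₄).subtype f₅ Subtype.val_injective h₅ (fun e => by
      constructor
      · intro he
        obtain ⟨d, rfl⟩ := (h₄₅ e).mp he
        exact ⟨⟨f₄ d, d, rfl⟩, rfl⟩
      · rintro ⟨⟨e', d, rfl⟩, rfl⟩
        exact (h₄₅ (f₄ d)).mpr ⟨d, rfl⟩)
  rw [eB, eC, eD, eE]
  simp only [add_comm, add_left_comm, add_assoc]

end Algebra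

/-! ## §2 The Čech six-term sequence -/

section Cech

variable {R : Type u} [CommRing R] {X : Scheme.{u}} (f : X ⟶ Spec (.of R))
variable {ι : Type v} (U : ι → X.Opens) {M' M M'' : X.Modules} {φ : M' ⟶ M} {ψ : M ⟶ M''}

/-- **`ℓȞ⁰(M′) + ℓȞ⁰(M″) + ℓȞ¹(M) = ℓȞ⁰(M) + ℓȞ¹(M′) + ℓȞ¹(M″)`** for a sectionwise exact `0 → M′ → M → M″ → 0` on
the family `𝒰` with `Ȟ¹(𝒰, M) → Ȟ¹(𝒰, M″)` surjective (e.g. `Ȟ²(𝒰, M′) = 0`) — additivity of the Euler characteristic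
`χ = ℓȞ⁰ − ℓȞ¹` in subtraction-free form. [cite: Lipman1969, Section 10 (p. 212)]
[cite: Hartshorne1977, III Thm. 4.5 proof p. 222 (long exact sequence of Čech cohomology)] -/
theorem CechExactData.length_cechMH0_add (h : CechExactData f U φ ψ)
    (hsurj : Function.Surjective (cechMapH1 f ψ U)) :
    Module.length R (cechMH0 f M' U) + Module.length R (cechMH0 f M'' U) + Module.length R (CechMH1 f M U) =
      Module.length R (cechMH0 f M U) + Module.length R (CechMH1 f M' U) + Module.length R (CechMH1 f M'' U) := by
  refine length_six_term_of_exact (cechMapH0 f φ U) (cechMapH0 f ψ U) h.cechDelta (cechMapH1 f φ U)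
    (cechMapH1 f ψ U) h.cechMapH0_injective ?_ ?_ ?_ ?_ hsurj
  · -- exactness at `Ȟ⁰(M)`
    intro b
    constructor
    · intro hb
      obtain ⟨b', hb'⟩ := h.exists_cechMapH0_eq b hb
      exact ⟨b', hb'⟩
    · rintro ⟨b', rfl⟩
      apply Subtype.ext
      funext i
      rw [cechMapH0_coe, cechMapC0_apply, cechMapH0_coe, cechMapC0_apply, h.app_app]
      rfl
  · -- exactness at `Ȟ⁰(M″)`
    intro b''
    constructor
    · intro hb
      obtain ⟨b, hb⟩ := h.exists_cechMapH0_eq_of_cechDelta_eq_zero b'' hb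
      exact ⟨b, hb⟩
    · rintro ⟨b, rfl⟩
      exact h.cechDelta_cechMapH0 b
  · -- exactness at `Ȟ¹(M′)`
    intro y
    constructor
    · intro hy
      obtain ⟨b'', hb''⟩ := h.exists_cechDelta_eq y hy
      exact ⟨b'', hb''⟩
    · rintro ⟨b'', rfl⟩
      exact h.cechMapH1_cechDelta b''
  · -- exactness at `Ȟ¹(M)`
    intro y
    constructor
    · intro hy
      obtain ⟨y', hy'⟩ := h.exists_cechMapH1_eq y hy
      exact ⟨y', hy'⟩
    · rintro ⟨y', rfl⟩
      exact h.cechMapH1_cechMapH1 y'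

end Cech

end Literature.AlgebraicGeometry.Morphisms

end
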